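import Literature.NumberTheory.Automorphic.UnitaryGroupEllipticCentralizerCompactTwo
import Literature.NumberTheory.Automorphic.UnitaryGroupTruncatedKernelClassOffBorel
import Literature.NumberTheory.Automorphic.UnitaryGroupTruncatedKernelClassMeasurable
import HarnessLib

/-!
# Elliptic reduction on `U(J₂)`: a class of rational elements missing the rational Borel has its
# class kernel supported in a compact set modulo `G(F)`, bounded, and integrable on `G(F)\G(𝔸_F)`
# (the `N = 2` twin of ★ `UnitaryGroupKernelClassEllipticSupport`)
(Arthur, *A trace formula for reductive groups I*, Duke Math. J. 45 (1978), §8 (the classes `𝔬`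
meeting no proper parabolic: «the function `K_𝔬(x, x)` … is compactly supported modulo `G(ℚ)`»);
Gelbart, *Automorphic forms on adele groups* (1975), Thm. 9.22 (ii) and Remark 9.23 (elliptic terms);
Rogawski, *Automorphic Representations of Unitary Groups in Three Variables* (1990), §2.2–2.3 and p. 98
«Let `G = U(3)`, `U(2)`, or `U(2) × U(1)`»; Godement, Sém. Bourbaki 257 (1962/63), §1.1, §3 (Mahler's criterion))

Topic `NumberTheory/Automorphic`; namespace `Literature.NumberTheory.Automorphic.UnitaryGroup`.
Proof file: THEOREMS ONLY over accepted tree modules (no definition, no named fact, no instance, no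
notation, no `sorry`). H-side copy of LAWS 1–5 for the endoscopic group `H = U(Φ₂) × U(Φ₁)` of the line
`Cruxes/H413/Lines/F0_T1InnerFormTraceIdentity.lean` (cell hodgecm-mathlib, crux H413; census
`CENSUS-LAWS-Hside` §3 LAW 4, sibling `KernelClassEllipticSupportTwo`): the accepted ★
`UnitaryGroupKernelClassEllipticSupport` is typed for `U(J₃)`; this file re-types it for `U(J₂)`
(★ `quasiSplit F E c 2`) over the `N = 2` letters ★ `exists_borelHeight_le_of_conj_mem_of_not_mem_arithmeticBorel_two`
and ★ `forall_inv_le_vecHeight_of_forall_borelHeight_le_two`, proofs verbatim (rank-one generic), names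
suffixed `_two`, no `c * c = 1` binder. Setting: `B(F) =` ★ `arithmeticBorel F E c 2`, height ★ `borelHeight`,
a class map `cl : G(F) → ι` with ★ `IsConjInvariant cl`, a class `𝔬 = i` MISSING `B(F)` (`hi : ∀ β ∈ B(F),
cl β ≠ i`; every rational conjugate then misses `B(F)`, ★ `forall_conj_not_mem_arithmeticBorel_of_forall_cl_ne`),
and the class kernel ★ `kernelClass cl i f x x = Σ_{γ ∈ 𝔬} f(x⁻¹γx)` (every `N`).

THE POINT — ELLIPTIC REDUCTION (§1): **if `x⁻¹ γ x` lies in a compact `Ω` for a rational `γ` none of whose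
rational conjugates is in `B(F)`, then `x ∈ G(F) · Kc` for a compact `Kc` depending only on `Ω`** (for EVERY
`δ ∈ G(F)`, `(δx)⁻¹ (δγδ⁻¹) (δx) = x⁻¹γx ∈ Ω` with `δγδ⁻¹ ∉ B(F)`, so `H(δx) ≤ c₀(Ω)`; then Mahler's
criterion ★ `exists_isCompact_forall_exists_toAdelic_mul_mem`). CONSEQUENCES for the class kernel of
`f ∈ C_c(G(𝔸_F))` (§2–§3): `K_𝔬(x, x) ≠ 0 ⇒ x ∈ G(F) · Kc`, `‖K_𝔬(x, x)‖ ≤ M` uniformly, hence — the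
automorphic quotient having FINITE volume — **the descended class kernel is integrable on `G(F)\G(𝔸_F)` for
EVERY continuous compactly supported `f`**, and so is the class truncated kernel `k^T_𝔬 = K_𝔬` (★
`truncatedKernelClass_eq_kernelClass_of_forall_ne`, every `N`).

* §1 **`exists_isCompact_forall_conj_mem_of_forall_not_mem_arithmeticBorel_two`** (elliptic reduction).
* §2 (private plumbing) `exists_isCompact_forall_kernelClass_diag_ne_zero_two` (compact support mod `G(F)`),
  `exists_forall_norm_kernelClass_diag_le_two` (uniform bound).
* §3 `measurable_quotFun_kernelClass_diag_two`; **`integrable_quotFun_kernelClass_diag_of_forall_ne_two`**;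
  `lintegral_enorm_quotFun_kernelClass_diag_lt_top_two`; **`integrable_quotFun_truncatedKernelClass_of_forall_ne_two`**
  (every `T`, `ν`, `𝓕`, every `f ∈ C_c`; ★ `integrable_quotFun_truncatedKernelClass_iff_of_forall_ne`).

## References

* J. Arthur, *A trace formula for reductive groups I*, Duke Math. J. 45 (1978), §8 [Arthur1978TraceFormulaI].
* S. Gelbart, *Automorphic forms on adele groups*, Ann. of Math. Studies 83 (1975), Thm. 9.22 (ii),
  Remark 9.23 [Gelbart1975].
* J. D. Rogawski, *Automorphic Representations of Unitary Groups in Three Variables*, Ann. of Math.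
  Studies 123 (1990), §2.2–2.3 (pp. 12–14), §7.3 (p. 98) [Rogawski1990].
* R. Godement, *Domaines fondamentaux des groupes arithmétiques*, Sém. Bourbaki 257 (1962/63), §1.1,
  §3 [Godement1964].
-/

set_option autoImplicit false

noncomputable section

open MeasureTheory Measure NumberField IsDedekindDomain Set
open scoped NNReal ENNReal Pointwise

namespace Literature.NumberTheory.Automorphic

namespace UnitaryGroup

variable {F E : Type} [Field F] [NumberField F] [Field E] [NumberField E] [Algebra F E]
  {c : E ≃ₐ[F] E} {ι : Type*}

/-! ## §1 Elliptic reduction: conjugating an elliptic rational element into a compact set -/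

/-- **ELLIPTIC REDUCTION on `U(J₂)`.** For a compact `Ω ⊆ G(𝔸_F)` there is a compact `Kc ⊆ G(𝔸_F)`
such that whenever `x⁻¹ γ x ∈ Ω` for a rational `γ` NONE of whose rational conjugates lies in the
rational Borel `B(F)`, some rational translate of `x` lies in `Kc` — i.e. `x ∈ G(F) · Kc`. (For every
`δ ∈ G(F)`, `(δx)⁻¹ (δγδ⁻¹) (δx) = x⁻¹ γ x ∈ Ω` and `δγδ⁻¹ ∉ B(F)`, so `H(δ x) ≤ c₀(Ω)`
(★ `exists_borelHeight_le_of_conj_mem_of_not_mem_arithmeticBorel_two`); then Mahler's criterion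
(★ `forall_inv_le_vecHeight_of_forall_borelHeight_le_two`, ★ `exists_isCompact_forall_exists_toAdelic_mul_mem`).)
[cite: Godement1964, §1.1 and §3] [cite: Gelbart1975, Thm. 9.22 (ii) and Remark 9.23] -/
theorem exists_isCompact_forall_conj_mem_of_forall_not_mem_arithmeticBorel_two
    {Ω : Set (quasiSplit F E c 2).Adelic} (hΩ : IsCompact Ω) :
    ∃ Kc : Set (quasiSplit F E c 2).Adelic, IsCompact Kc ∧
      ∀ (x : (quasiSplit F E c 2).Adelic) (γ : (quasiSplit F E c 2).arithmeticSubgroup),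
        (∀ δ : (quasiSplit F E c 2).arithmeticSubgroup, δ * γ * δ⁻¹ ∉ arithmeticBorel F E c 2) →
        x⁻¹ * (γ : (quasiSplit F E c 2).Adelic) * x ∈ Ω →
        ∃ δ : (quasiSplit F E c 2).Rational, (quasiSplit F E c 2).toAdelic δ * x ∈ Kc := by
  obtain ⟨c₀, hc₀⟩ := exists_borelHeight_le_of_conj_mem_of_not_mem_arithmeticBorel_two (c := c) hΩ
  have hT : (1 : ℝ≥0) ≤ max 1 c₀ := le_max_left _ _
  have hε : (0 : ℝ≥0) < (max 1 c₀)⁻¹ := inv_pos.2 (lt_of_lt_of_le one_pos hT)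
  obtain ⟨Kc, hKc, hMah⟩ :=
    exists_isCompact_forall_exists_toAdelic_mul_mem (F := F) (E := E) (c := c) (N := 2) hε
  refine ⟨Kc, hKc, fun x γ hγ hx => hMah x
    (forall_inv_le_vecHeight_of_forall_borelHeight_le_two hT fun δ => ?_)⟩
  refine (hc₀ ((δ : (quasiSplit F E c 2).Adelic) * x) (δ * γ * δ⁻¹) (hγ δ) ?_).trans (le_max_right _ _)
  have hconj : ((δ : (quasiSplit F E c 2).Adelic) * x)⁻¹ *
      ((δ * γ * δ⁻¹ : (quasiSplit F E c 2).arithmeticSubgroup) : (quasiSplit F E c 2).Adelic) *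
        ((δ : (quasiSplit F E c 2).Adelic) * x) = x⁻¹ * (γ : (quasiSplit F E c 2).Adelic) * x := by
    push_cast
    group
  rw [hconj]
  exact hx

/-! ## §2 The class kernel of a class missing `B(F)`: compact support modulo `G(F)` and a uniform bound -/

/-- **The class kernel of a class missing `B(F)` is supported in a compact set modulo `G(F)`**
(Arthur (1978), §8: for `𝔬` meeting no proper parabolic, `x ↦ K_𝔬(x, x)` is compactly supported
modulo `G(F)`): for `f` of compact support there is a compact `Kc` with
`K_𝔬(x, x) ≠ 0 ⇒ ∃ δ ∈ G(F), δ x ∈ Kc`. [cite: Gelbart1975, Thm. 9.22 (ii) and Remark 9.23]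
[cite: Rogawski1990, §2.2 (p. 13)] -/
private theorem exists_isCompact_forall_kernelClass_diag_ne_zero_two
    {cl : (quasiSplit F E c 2).arithmeticSubgroup → ι} (hcl : IsConjInvariant cl) {i : ι}
    (hi : ∀ β : arithmeticBorel F E c 2, cl β ≠ i) {f : (quasiSplit F E c 2).Adelic → ℂ}
    (hf : HasCompactSupport f) :
    ∃ Kc : Set (quasiSplit F E c 2).Adelic, IsCompact Kc ∧
      ∀ x : (quasiSplit F E c 2).Adelic, kernelClass cl i f x x ≠ 0 →
        ∃ δ : (quasiSplit F E c 2).Rational, (quasiSplit F E c 2).toAdelic δ * x ∈ Kc := by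
  obtain ⟨Kc, hKc, hred⟩ :=
    exists_isCompact_forall_conj_mem_of_forall_not_mem_arithmeticBorel_two hf.isCompact
  refine ⟨Kc, hKc, fun x hx => ?_⟩
  -- some `γ` of the class has `f(x⁻¹ γ x) ≠ 0`
  by_contra hnone
  refine hx (kernelClass_eq_zero_of_forall cl fun γ hγ => ?_)
  by_contra hne
  exact hnone (hred x γ (forall_conj_not_mem_arithmeticBorel_of_forall_cl_ne hcl hi hγ)
    (subset_tsupport _ (Function.mem_support.2 hne)))

/-- **The class kernel of a class missing `B(F)` is uniformly bounded**: `‖K_𝔬(x, x)‖ ≤ M` for all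
`x ∈ G(𝔸_F)`, for `f ∈ C_c`. (Diagonal `G(F)`-invariance ★ `kernelClass_diag_rational_mul` moves `x`
into the compact `Kc` of the support lemma; for `k ∈ Kc` only the finitely many rational `γ` in the
compact `Kc · supp f · Kc⁻¹` contribute (★ `finite_setOf_mem_arithmeticSubgroup_of_isCompact`), each
term at most `sup ‖f‖`.) [cite: Gelbart1975, Thm. 9.22 (ii) and Remark 9.23] [cite: Rogawski1990, §2.2 (p. 13)] -/
private theorem exists_forall_norm_kernelClass_diag_le_two
    {cl : (quasiSplit F E c 2).arithmeticSubgroup → ι} (hcl : IsConjInvariant cl) {i : ι}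
    (hi : ∀ β : arithmeticBorel F E c 2, cl β ≠ i) {f : (quasiSplit F E c 2).Adelic → ℂ}
    (hfc : Continuous f) (hf : HasCompactSupport f) :
    ∃ M : ℝ, 0 ≤ M ∧ ∀ x : (quasiSplit F E c 2).Adelic, ‖kernelClass cl i f x x‖ ≤ M := by
  obtain ⟨Kc, hKc, hsupp⟩ := exists_isCompact_forall_kernelClass_diag_ne_zero_two hcl hi hf
  -- the finitely many rational `γ` with a conjugate by `Kc` in the support
  have hC : IsCompact (Kc * tsupport f * Kc⁻¹) := (hKc.mul hf.isCompact).mul hKc.inv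
  have hfin := finite_setOf_mem_arithmeticSubgroup_of_isCompact hC
    (1 : (quasiSplit F E c 2).Adelic) (1 : (quasiSplit F E c 2).Adelic)
  obtain ⟨B, hB⟩ := hf.exists_bound_of_continuous hfc
  have hB0 : 0 ≤ B := (norm_nonneg _).trans (hB 1)
  refine ⟨hfin.toFinset.card * B, mul_nonneg (Nat.cast_nonneg _) hB0, fun x => ?_⟩
  by_cases hx : kernelClass cl i f x x = 0
  · rw [hx, norm_zero]; exact mul_nonneg (Nat.cast_nonneg _) hB0
  obtain ⟨δ, hδ⟩ := hsupp x hx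
  -- move `x` into `Kc` by the rational `δ`
  set k : (quasiSplit F E c 2).Adelic := (quasiSplit F E c 2).toAdelic δ * x with hk
  have hδmem : (quasiSplit F E c 2).toAdelic δ ∈ (quasiSplit F E c 2).arithmeticSubgroup := ⟨δ, rfl⟩
  have hinv : kernelClass cl i f x x = kernelClass cl i f k k := by
    rw [hk]
    exact (kernelClass_diag_rational_mul hcl i f ⟨_, hδmem⟩ x x).symm
  rw [hinv, kernelClass_def]
  -- at `k ∈ Kc` only the finitely many `γ ∈ Kc · supp f · Kc⁻¹` contribute
  set g : (quasiSplit F E c 2).arithmeticSubgroup → ℝ := fun γ =>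
    ‖f (k⁻¹ * (γ : (quasiSplit F E c 2).Adelic) * k)‖ with hg
  have hterm : ∀ γ : (quasiSplit F E c 2).arithmeticSubgroup, g γ ≠ 0 → γ ∈ hfin.toFinset := by
    intro γ hγ
    rw [Set.Finite.mem_toFinset, Set.mem_setOf_eq, inv_one, one_mul, mul_one]
    have hne : f (k⁻¹ * (γ : (quasiSplit F E c 2).Adelic) * k) ≠ 0 := fun h0 => hγ (by
      rw [hg]; simp only [h0, norm_zero])
    have hmem : k⁻¹ * (γ : (quasiSplit F E c 2).Adelic) * k ∈ tsupport f :=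
      subset_tsupport _ (Function.mem_support.2 hne)
    have : (γ : (quasiSplit F E c 2).Adelic) =
        k * (k⁻¹ * (γ : (quasiSplit F E c 2).Adelic) * k) * k⁻¹ := by group
    rw [this]
    exact Set.mul_mem_mul (Set.mul_mem_mul hδ hmem) (Set.inv_mem_inv.2 hδ)
  have hg0 : ∀ γ, 0 ≤ g γ := fun γ => norm_nonneg _
  have hgs : Summable g :=
    summable_of_hasFiniteSupport (hfin.toFinset.finite_toSet.subset fun γ hγ => by
      simpa using hterm γ hγ)
  calc ‖∑' γ : ↥(cl ⁻¹' {i}),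
        f (k⁻¹ * ((γ : (quasiSplit F E c 2).arithmeticSubgroup) : (quasiSplit F E c 2).Adelic) * k)‖
      ≤ ∑' γ : ↥(cl ⁻¹' {i}), g γ := norm_tsum_le_tsum_norm (hgs.subtype _)
    _ ≤ ∑' γ, g γ := Summable.tsum_subtype_le g _ hg0 hgs
    _ = ∑ γ ∈ hfin.toFinset, g γ := tsum_eq_sum fun γ hγ => by
        by_contra hne
        exact hγ (hterm γ hne)
    _ ≤ ∑ γ ∈ hfin.toFinset, B := Finset.sum_le_sum fun γ _ => hB _
    _ = hfin.toFinset.card * B := by rw [Finset.sum_const, nsmul_eq_mul]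

/-! ## §3 Integrability of the class kernel on the automorphic quotient -/

section Quotient

variable [MeasurableSpace (quasiSplit F E c 2).Adelic] [BorelSpace (quasiSplit F E c 2).Adelic]

/-- **The descended class kernel `[g] ↦ K_𝔬(g⁻¹, g⁻¹)` is Borel on `G(𝔸_F) ⧸ G(F)`** for continuous `f`
and a conjugation-invariant class map (honest descent by diagonal `G(F)`-invariance
★ `kernelClass_diag_rational_mul`; Borel measurability descends along the closed `G(F)`,
★ `measurable_quotient_iff`, as in ★ `measurable_quotFun_truncatedKernelClass`). [cite: Rogawski1990, §2.2 (p. 13)] -/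
theorem measurable_quotFun_kernelClass_diag_two {cl : (quasiSplit F E c 2).arithmeticSubgroup → ι}
    (hcl : IsConjInvariant cl) (i : ι) {f : (quasiSplit F E c 2).Adelic → ℂ} (hf : Continuous f) :
    Measurable ((quasiSplit F E c 2).quotFun fun g => kernelClass cl i f g g) := by
  haveI := secondCountableTopology_adeleRing E
  haveI := locallyCompactSpace_adeleRing' E
  haveI : T2Space (quasiSplit F E c 2).Adelic :=
    inferInstanceAs (T2Space (adelic F E c 2 ((StdForm.antidiagonal 2).over E)))
  haveI : LocallyCompactSpace (quasiSplit F E c 2).Adelic :=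
    inferInstanceAs (LocallyCompactSpace (adelic F E c 2 ((StdForm.antidiagonal 2).over E)))
  haveI : SecondCountableTopology (quasiSplit F E c 2).Adelic :=
    inferInstanceAs (SecondCountableTopology (adelic F E c 2 ((StdForm.antidiagonal 2).over E)))
  letI : MeasurableSpace ((quasiSplit F E c 2).Adelic ⧸ (quasiSplit F E c 2).quotientSubgroup) :=
    (quasiSplit F E c 2).instMeasurableSpaceAutomorphicQuotient
  haveI : BorelSpace ((quasiSplit F E c 2).Adelic ⧸ (quasiSplit F E c 2).quotientSubgroup) :=
    (quasiSplit F E c 2).instBorelSpaceAutomorphicQuotient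
  have hmeas := (Literature.MeasureTheory.Group.measurable_quotient_iff
    (G := (quasiSplit F E c 2).Adelic) (H := (quasiSplit F E c 2).quotientSubgroup)
    isClosed_quotientSubgroup_quasiSplit
    (F := (quasiSplit F E c 2).quotFun fun g => kernelClass cl i f g g)).2
  have hinv : ∀ γ ∈ (quasiSplit F E c 2).quotientSubgroup, ∀ g : (quasiSplit F E c 2).Adelic,
      kernelClass cl i f (γ * g) (γ * g) = kernelClass cl i f g g := by
    intro γ hγ g
    rw [quotientSubgroup_quasiSplit] at hγ
    exact kernelClass_diag_rational_mul hcl i f ⟨γ, hγ⟩ g g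
  have heq : ((quasiSplit F E c 2).quotFun fun g => kernelClass cl i f g g) ∘
      (QuotientGroup.mk : (quasiSplit F E c 2).Adelic →
        (quasiSplit F E c 2).Adelic ⧸ (quasiSplit F E c 2).quotientSubgroup) =
        fun g => kernelClass cl i f g⁻¹ g⁻¹ := by
    funext g
    exact AdelicGroupData.quotFun_toAutomorphicQuotient hinv g
  exact hmeas (heq ▸ (measurable_kernelClass_diag cl i hf).comp measurable_inv)

/-- **The class kernel of a class missing `B(F)` is integrable on `G(F)\G(𝔸_F)`** for EVERY
`f ∈ C_c(U(J₂)(𝔸_F))` and every finite measure `μ` on the automorphic quotient (in particular every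
automorphic measure, ★ `IsAutomorphicMeasure` ⊇ `IsFiniteMeasure`): it is Borel and uniformly bounded
(§2). The elliptic case of «`k^T_𝔬` is integrable over `𝐙G\𝐆`» [Rogawski1990, §2.2; Arthur 1978
Thm. 7.1], with no truncation and no smoothness. [cite: Gelbart1975, Thm. 9.22 (ii) and Remark 9.23]
[cite: Rogawski1990, §2.2 (p. 13)] -/
theorem integrable_quotFun_kernelClass_diag_of_forall_ne_two
    {cl : (quasiSplit F E c 2).arithmeticSubgroup → ι} (hcl : IsConjInvariant cl) {i : ι}
    (hi : ∀ β : arithmeticBorel F E c 2, cl β ≠ i) {f : (quasiSplit F E c 2).Adelic → ℂ}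
    (hfc : Continuous f) (hf : HasCompactSupport f)
    (μ : Measure (quasiSplit F E c 2).automorphicQuotient) [IsFiniteMeasure μ] :
    Integrable ((quasiSplit F E c 2).quotFun fun g => kernelClass cl i f g g) μ := by
  obtain ⟨M, -, hM⟩ := exists_forall_norm_kernelClass_diag_le_two hcl hi hfc hf
  refine (MemLp.of_bound (measurable_quotFun_kernelClass_diag_two hcl i hfc).aestronglyMeasurable M
    (ae_of_all _ fun x => ?_)).integrable le_rfl
  exact hM _

/-- `[0, ∞]` reading: **`∫⁻ ‖K_𝔬(x, x)‖ₑ dμ < ∞`** on the automorphic quotient for `f ∈ C_c` and a class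
missing `B(F)` — at `f := ‖·‖ ∘ f` this is the absolute-convergence input `hfin` of the orbital-integral
unfolding (★ `integral_conjTsum_eq_tsum_of_lintegral_complex`). [cite: Gelbart1975, Thm. 9.22 (ii) and Remark 9.23] -/
theorem lintegral_enorm_quotFun_kernelClass_diag_lt_top_two
    {cl : (quasiSplit F E c 2).arithmeticSubgroup → ι} (hcl : IsConjInvariant cl) {i : ι}
    (hi : ∀ β : arithmeticBorel F E c 2, cl β ≠ i) {f : (quasiSplit F E c 2).Adelic → ℂ}
    (hfc : Continuous f) (hf : HasCompactSupport f)
    (μ : Measure (quasiSplit F E c 2).automorphicQuotient) [IsFiniteMeasure μ] :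
    ∫⁻ x, ‖(quasiSplit F E c 2).quotFun (fun g => kernelClass cl i f g g) x‖ₑ ∂μ < ∞ :=
  (integrable_quotFun_kernelClass_diag_of_forall_ne_two hcl hi hfc hf μ).2

variable [MeasurableSpace (adelicUnipotent F E c 2)]

/-- **The class truncated kernel `k^T_𝔬` of a class missing `B(F)` is integrable** on the automorphic
quotient for EVERY cut-off `T`, every measure `ν` and set `𝓕` on `N(𝔸_F)`, every `f ∈ C_c` and every
finite `μ`: it IS the class kernel (★ `truncatedKernelClass_eq_kernelClass_of_forall_ne`).
[cite: Rogawski1990, §2.2 (p. 13)] [cite: Gelbart1975, Thm. 9.22 (ii) and Remark 9.23] -/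
theorem integrable_quotFun_truncatedKernelClass_of_forall_ne_two
    {cl : (quasiSplit F E c 2).arithmeticSubgroup → ι} (hcl : IsConjInvariant cl) {i : ι}
    (hi : ∀ β : arithmeticBorel F E c 2, cl β ≠ i) {f : (quasiSplit F E c 2).Adelic → ℂ}
    (hfc : Continuous f) (hf : HasCompactSupport f) (ν : Measure (adelicUnipotent F E c 2))
    (𝓕 : Set (adelicUnipotent F E c 2)) (T : ℝ≥0)
    (μ : Measure (quasiSplit F E c 2).automorphicQuotient) [IsFiniteMeasure μ] :
    Integrable ((quasiSplit F E c 2).quotFun (truncatedKernelClass ν 𝓕 T cl i f)) μ := by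
  rw [integrable_quotFun_truncatedKernelClass_iff_of_forall_ne hi μ ν 𝓕 T f]
  exact integrable_quotFun_kernelClass_diag_of_forall_ne_two hcl hi hfc hf μ

end Quotient

end UnitaryGroup

end Literature.NumberTheory.Automorphic

end
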